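import Literature.MathematicalPhysics.QuantumFieldTheory.BalabanImbrieJaffe1984to88.BIJ88Eq533Torus
import Literature.MathematicalPhysics.QuantumFieldTheory.BalabanImbrieJaffe1984to88.BIJ88Smooth43Phase

/-!
# `BalabanImbrieJaffe1984to88.BIJ88Eq564Torus` — T. Bałaban, J. Imbrie, A. Jaffe, *Effective action and cluster properties of the abelian
Higgs model*, Commun. Math. Phys. **114** (1988) 257–315 [BalabanImbrieJaffe1988], Sect. 5.6 p. 286 [PDF 30]: **(5.6.3)–(5.6.4)** — the
η-lattice passage in the verification of the regularity condition (4.3) — and the sentence *"Note that Q^{s*}_ke^{ie_k∂λ} is a gauge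
transformation (generated by Q′^*_kλ), so we can delete it from u_k"*, ON THE TORUS CARRIER OF RECORD (kind «model instance»).

statement-level skeleton of published theorems with citation tags; proofs where landed; nothing here is a claim about the Yang–Mills mass gap

PDF held: `paper:balaban1988-cmp114-bij-abelian-higgs-effective-action` (journal page = PDF page + 256), p. 286 [PDF 30] read as an image
(CCITT-G4 render ×2, seat folder `renders/original-p030-x2.png`); p. 274 [PDF 18] ((4.2)) as quoted verbatim in r18's
`BIJ88Sect4Statements.backgroundU`; [BalabanImbrieJaffe1985] p. 312 [PDF 14] ((4.5.2)–(4.5.3)) read earlier by this seat (gen 3).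

CITATION HEADER (lean-in-tree rule).  Part of the lit-balaban TYPED SKELETON (HOME `run/shared/lean/pub/lit-balaban/`), PHASE-2 proof
seat p31 gen 6 (unit `lit-balaban-p31-g6`; TAKING line HOME/STATUS.md 2026-08-21T10:00Z; second file of the gen after `BIJ88Eq533Torus`
p259957).  WHAT IS REPRODUCED: row `C2.Claim@286` of `HOME/lit-balaban-r16/ROWS-C2-part2.md` (owner r16; claim typed by r16 as
`BIJ88Regularity286.Regular286`, whose honest-scope note *"no bound is asserted"* this file and seat p36 gen 6's `BIJ88Smooth43Axial`
(p259908: the unit-lattice Poincaré step *"u = exp[ie_k(∂λ + B)] … f^{(k)} = ∂B"*) start to fill from the two ends), members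
**(5.6.3)–(5.6.4)** and the two sentences after (5.6.4) — the part p36's file lists as NOT touched.

THE PRINTED TEXT (verbatim, p. 286 [PDF 30]).  *"We verify the bound by first checking it for u_k, then noticing that all the operations
changing u_k into ũ_{k+1} did not destroy the bound. We use the new bounds on u(p) in Λ₀^{(k)**} to estimate u_k = (Q^{s*}_ku) exp[−ie_kη
𝒟_{k,loc}∂*Q^{e*}_kf^{(k)}] (5.6.3) with constants uniform in k. … Fix □ ⊂ Λ̄₁^{(k)} for estimating ũ_{k+1}. In □′ [a neighborhood of □ of
width ½r(e_k)] we can write u = exp[ie_k(∂λ + B)] with |B(b)| ≦ cp(e_k)r(e_k). We have f^{(k)} = ∂B in the cube, and so u_k = (Q^{s*}_ke^{ie_k∂λ})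
exp ie_kη[(Q^{s*}_k − 𝒟_{k,loc}∂*Q^{e*}_k∂)B]. (5.6.4) We have used the fact that 𝒟_{k,loc} has range (1/2L)r(e_{k−1}). Note that Q^{s*}_ke^{ie_k∂λ}
is a gauge transformation (generated by Q′^*_kλ), so we can delete it from u_k. Our desired bound now follows because by (5.4.4),
(Q^{s*}_k − 𝒟_{k,loc}∂*Q^{e*}_k∂)□′B = (H_{k,loc} + ∂C_k + w₁)□′B. (5.6.5)"*.

WHAT (5.6.4) IS, and what is data.  (5.6.3) is (4.2) (r18's `backgroundU ek η (Q^{s*}_ku) g`, `g = 𝒟_{k,loc}∂*Q^{e*}_kf^{(k)}` a real η-bond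
function).  The decomposition `u = exp[ie_k(∂λ + B)]` on the bonds `□′*` is the HYPOTHESIS `hu` (on the torus it is p36's theorem, with
`B = axialB`, `λ = lamOf h`); `∂λ` = `LatticeFieldCalculus.grad 1 λ`.  (5.6.4) then follows from the ALGEBRA OF THE GROUP-VALUED PULL-BACK
[BalabanImbrieJaffe1985] (4.5.3) (gen 3's `BIJ85Eq453GaugeField.qsstarGIter`): multiplicativity and the U(1) dictionary (4.5.2) with `ηL^k = 1`
(`BIJ88Eq533Torus`), on the η-bonds under `□′` — together with the displayed locality *"𝒟_{k,loc} has range (1/2L)r(e_{k−1})"*, typed as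
the hypothesis `hT : g(b) = (T∂B)(b)` on the bond considered (`T` = `𝒟_{k,loc}∂*Q^{e*}_k`, data).  The sentence *"Q^{s*}_ke^{ie_k∂λ} is a gauge
transformation (generated by Q′^*_kλ)"* is the GRADIENT INTERTWINING `Q^{s*}_k∂ = ∂^ηQ′^*_k` (`Q′^*_kλ = λ∘B^k`, the pull-back of site
functions; companion of the curl identity `∂Q^{s*} = Q^{e*}∂` of [BalabanImbrieJaffe1985] p. 317, gen 2's `BIJ85CurlQsstar`), in group form
gen 3's gauge covariance `qsstarGIter_gaugeAct` at the trivial field; *"so we can delete it from u_k"* is r16's `regular286_of_eqOn_gaugeU`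
(the regularity predicate is gauge invariant), applied.

CARRIERS (all of record): η-lattice = torus level `i`, unit lattice = level `i + k` (standing range `i + k ≤ m + K`), `U(1) =
BIJ88Sect3Statements.U1` read in `ℂ` (`toC`, `cfg`), r18's real gauge functions `BIJ88Sect3Statements.gaugeU` and (4.16) `bgGaugeU`, r16's
`BIJ88Regularity286.Regular286`/`cubeSites`, gen 6's `BIJ88Eq533Torus.blockUnion` (`Λ̄`), `starB` (`X*`).

WHAT IS PROVED (theorems only; 0 `sorry`, standard axioms, no `def`, no `Prop`-valued fact introduced).
* §1 *"generated by Q′^*_kλ"*: **`Qsstar_grad`** (`Q^{s*}_k(∂^cλ) = ∂^{cL^k}(λ∘B^k)` for the real operators — at `ηL^k = 1`, `c = 1`: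
  `Q^{s*}_k∂ = ∂^ηQ′^*_k`, `Qsstar_grad_eta`), `qsstarGIter_one`, **`qsstarGIter_gaugeAct_one`** (`Q^{s*}_k(1^g) = 1^{g∘B^k}`, any gauge group),
  `gaugeAct_one_eq_phaseField` (`1^g` for `g = e^{−ie_kλ}` IS `e^{ie_k∂λ}`), **`cfg_qsstarGIter_pureGauge`** (`Q^{s*}_ke^{ie_k∂λ} = e^{ie_k∂(λ∘B^k)}`
  read in `ℂ`, bond by bond), `cfg_qsstarGIter_pureGauge_eq_gaugeU` (= r18's `gaugeU (−e_kλ∘B^k) 1`), `cfg_qsstarGIter_pureGauge_eq_bgGaugeU`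
  (= (4.16) `bgGaugeU e_k η (−λ∘B^k) 1`, any `η ≠ 0`).
* §2 the dictionary without cut-off `toC_qsstarGIter_phaseField`, and **(5.6.4) ON THE TORUS**: `eq564_torus` (on every η-bond under `□′`:
  `u_k(b) = (Q^{s*}_ke^{ie_k∂λ})(b) · exp ie_kη[(Q^{s*}_kB)(b) − g(b)]`), **`eq564`** (with `hT`: `= (Q^{s*}_ke^{ie_k∂λ})(b) · exp ie_kη[((Q^{s*}_k −
  T∂)B)(b)]`, the display); *"We have f^{(k)} = ∂B in the cube"*: `plaqHol_eq_of_bonds`, **`fieldStrength_eq_curl`** (for `u = e^{ie_k(∂λ+B)}` on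
  the four bonds of `p` and `|e_k(∂B)(p)| < π`: `f^{(k)}(p) = (∂B)(p)` — `curl_grad`), `fieldStrength_eq_curl_of_mem_starP`.
* §3 *"so we can delete it from u_k"*: `eq564_gaugeU` (`u_k = gaugeU(−e_kλ∘B^k)(exp ie_kη[Q^{s*}_kB − g])` on the bonds under `□′`),
  `starB_mono`, **`regular286_of_deleted`** (r16's `Regular286` for `u_k` on any family of cubes inside `□̄′ = blockUnion k X` follows from
  `Regular286` of the gauge-deleted field `exp ie_kη[(Q^{s*}_kB − g)]`).
* §4 (v1.1) THE PARAGRAPH ASSEMBLED, *"Our desired bound now follows because by (5.4.4), (5.6.5) … The kernels H_{k,loc}, w₁ and their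
  derivatives are bounded, so A^λ, ∂A^λ, ∂*A^λ are finally all bounded by cp(e_k)r(e_k)"*: `expU1_of_gaugeU_eq_exp` (the (4.3)
  representation `u^λ(b) = e^{ie_kA(b)}` — first clause of r18's `Smooth43` at `ζ = 1`, on the torus p36's
  `BIJ88Smooth43Axial.gaugeU_axial_eq_exp` — read back as the hypothesis `hu`: `u(b) = exp[ie_k((∂(λ/e_k))(b) + A(b))]`),
  **`regular286_backgroundU_of_bounds`** (`Regular286` of `u_k` on the cubes inside `□̄′` from the three printed bounds `|G|, |∂^ηG|, |∂^{η*}G|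
  ≦ cp(e_k)r(e_k)` on the gauge-deleted exponent `G = Q^{s*}_kB − g` — `regular286_of_deleted` + p36's `BIJ88Smooth43Phase.regular286_exp`),
  **`regular286_backgroundU_of_kernel`** (the printed hence-chain: (5.6.5) on the cube bonds, `(Q^{s*}_kB − g)(b) = Σ_{b′}K(b,b′)B′(b′)` with
  `K` = in print `H_{k,loc} + ∂C_k + w₁` and `B′` = in print `□′B`, `|B′| ≦ M`, row sums of `K`, `∂^ηK`, `∂^{η*}K` bounded by `K₀, K₁, K₂` with
  `K_iM ≦ cp(e_k)r(e_k)` ⟹ `Regular286` of `u_k` — p36's `smooth43_exp_kernel` + r16's `regular286_of_eqOn` + `regular286_of_deleted`).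
HONEST SCOPE.  Not here: the kernel bounds behind (5.6.5) (`H_{k,loc}`, `∂C_k`, `w₁` *"and their derivatives are bounded"* — analytic
inputs of Sect. 2) and the identity (5.6.5) for the concrete kernels (r16's `BIJ88Sect5StatementsPart3.eq565` proves it from (2.20) at the
operator level): they enter §4 as the displayed hypotheses `h565`, `hK₀`–`hK₂`, so the bound on `A^λ` is DERIVED FROM them, not asserted
unconditionally; the range statement for `𝒟_{k,loc}` enters as the displayed hypothesis `hT`; p36's unit-lattice step is taken as the
hypothesis `hu` (its dictionary form `expU1_of_gaugeU_eq_exp` is here).  Imports: this seat's `BIJ88Eq533Torus` (p259957) and p36 gen 6's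
`BIJ88Smooth43Phase` (p260437; it imports r16's `BIJ88Regularity286`).  v1.0 p260762 (§§1–3); v1.1 = §4 appended, nothing renamed.
Unit `lit-balaban-p31` (literature-prover-lit-balaban-p31-g6-0), 2026-08-21.
-/

namespace Literature.MathematicalPhysics.QuantumFieldTheory.BalabanImbrieJaffe1984to88.BIJ88Eq564Torus

open Literature.MathematicalPhysics.QuantumFieldTheory.Balaban1983to89
open BIJ88Sect3Statements (U1 toC toC_mul toC_one cfg gaugeU starB mem_starB starP fieldStrength)
open BIJ88Sect4Statements (backgroundU bgGaugeU Smooth43)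
open BIJ88Sect5StatementsPart3 (bgExp)
open BIJ88Regularity286 (Regular286 cubeSites regular286_of_eqOn_gaugeU regular286_of_eqOn)
open BIJ88Smooth43Phase (regular286_exp smooth43_exp_kernel)
open BIJ88Sect3Rescaling (toC_injective_U1)
open BIJ85BlockAveragesTorus (expU1 toC_expU1 toC_inv')
open BIJ85Eq453GaugeField (qsstarG qsstarGIter qsstarGIter_eq qsstarGIter_of_interior qsstarGIter_of_mem qsstarGIter_gaugeAct)
open BIJ85Eq224Proof (torusBlockBondsIter mem_BsIter_iff blockOfIter_shift iter_L)
open BIJ88Eq536Linearization (phaseField toC_phaseField)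
open BIJ88Eq533Torus (cutoffG cutoffG_of_mem blockUnion mem_blockUnion liftBonds mem_liftBonds liftBonds_starB_iff
  toC_qsstarGIter_cutoffG_phase)
open BIJ88Sect3Translations (fieldStrength_exp_of_small)
open B7SectAStatements (blockOfIter blockOfIter_zero blockOfIter_succ)
open LatticeFieldCalculus (grad curl diverg curl_grad curl_add)
open GaugeField (plaqHol gaugeAct)
open scoped BigOperators Real
open Complex Finset

noncomputable section

variable {P : Params} {i j : ℕ} {G : Type*}

/-! ## §0 Torus bookkeeping -/

/-- kernel: `y + e_μ ≠ y` on every torus of the series. [folklore] -/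
private theorem shift_ne_self {n : ℕ} (y : Balaban1983to89.Site P n) (μ : Fin P.d) : y.shift μ ≠ y := by
  intro h
  have h1 := congrFun h μ
  simp only [Balaban1983to89.Site.shift, Function.update_self] at h1
  exact one_ne_zero (add_eq_left.1 h1)

/-- kernel: lattice steps commute, `x + e_μ + e_ν = x + e_ν + e_μ`. [folklore] -/
private theorem shift_comm {n : ℕ} (x : Balaban1983to89.Site P n) (μ ν : Fin P.d) : (x.shift μ).shift ν = (x.shift ν).shift μ := by
  funext κ
  simp only [Balaban1983to89.Site.shift, Function.update_apply]
  split_ifs <;> subst_vars <;> simp_all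

/-- kernel: a bond strictly inside a k-block lies in no k-corridor. [cite: BalabanImbrieJaffe1985, (4.5.3) p.312] -/
private theorem not_mem_BsIter_of_interior {k : ℕ} {b : PBond P i} (hb : blockOfIter k b.tgt = blockOfIter k b.src)
    (c : PBond P (i + k)) : b ∉ (torusBlockBondsIter P i k).Bs c := by
  rw [mem_BsIter_iff]
  rintro ⟨h1, h2⟩
  exact shift_ne_self c.src c.dir (h2.symm.trans (hb.trans h1))

/-- kernel: the far endpoint of a bond not strictly inside a k-block (standing range). [cite: BalabanImbrieJaffe1985, (4.5.3) p.312] -/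
private theorem blockOfIter_tgt_of_not_interior {k : ℕ} (hk : i + k ≤ P.m + P.K) {b : PBond P i}
    (hb : blockOfIter k b.tgt ≠ blockOfIter k b.src) : blockOfIter k b.tgt = (blockOfIter k b.src).shift b.dir :=
  (blockOfIter_shift k hk b.src b.dir).resolve_left hb

/-- kernel: a bond not strictly inside a k-block lies in the k-corridor of its k-fold block bond (standing range).
[cite: BalabanImbrieJaffe1985, (4.5.3) p.312] -/
private theorem mem_BsIter_of_not_interior {k : ℕ} (hk : i + k ≤ P.m + P.K) {b : PBond P i}
    (hb : blockOfIter k b.tgt ≠ blockOfIter k b.src) :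
    b ∈ (torusBlockBondsIter P i k).Bs (⟨blockOfIter k b.src, b.dir⟩ : PBond P (i + k)) := by
  rw [mem_BsIter_iff]
  exact ⟨rfl, blockOfIter_tgt_of_not_interior hk hb⟩

/-! ## §1 *"Q^{s*}_ke^{ie_k∂λ} is a gauge transformation (generated by Q′^*_kλ)"* -/

/-- **The gradient intertwining `Q^{s*}_k∂ = ∂Q′^*_k`** for the real operators on the torus: pulling back the gradient `∂^cλ` of a
unit-lattice site function by (2.17) at block size `L^k` (factor `L^k`) gives the gradient, with constant `c·L^k`, of the pulled-back site
function `Q′^*_kλ = λ∘B^k` (constant on k-blocks: inside blocks both sides vanish, on the corridor of `c` both are `cL^k(λ(c₊) − λ(c₋))`) —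
*"generated by Q′^*_kλ"*; the companion of `∂Q^{s*}_k = Q^{e*}_k∂` (standing range). [cite: BalabanImbrieJaffe1988, (5.6.4) p.286] -/
theorem Qsstar_grad {k : ℕ} (hk : i + k ≤ P.m + P.K) (c : ℝ) (lam : Balaban1983to89.Site P (i + k) → ℝ) (b : PBond P i) :
    (torusBlockBondsIter P i k).Qsstar (grad c lam) b = grad (c * (P.L : ℝ) ^ k) (fun x => lam (blockOfIter k x)) b := by
  by_cases hb : blockOfIter k b.tgt = blockOfIter k b.src
  · rw [(torusBlockBondsIter P i k).Qsstar_of_not_mem _ (not_mem_BsIter_of_interior hb)]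
    simp [grad, hb]
  · rw [(torusBlockBondsIter P i k).Qsstar_of_mem _ (mem_BsIter_of_not_interior hk hb), iter_L]
    simp only [grad, smul_eq_mul, blockOfIter_tgt_of_not_interior hk hb, Nat.cast_pow]
    change (P.L : ℝ) ^ k * (c * (lam ((blockOfIter k b.src).shift b.dir) - lam (blockOfIter k b.src))) = _
    ring

/-- … in the units of Sect. 4–5 (`ηL^k = 1`): `Q^{s*}_k(∂λ) = ∂^η(λ∘B^k)` with `∂ = grad 1` on the unit lattice and `∂^η = grad η⁻¹` on `T_η`
(standing range). [cite: BalabanImbrieJaffe1988, (5.6.4) p.286] -/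
theorem Qsstar_grad_eta {k : ℕ} (hk : i + k ≤ P.m + P.K) {η : ℝ} (hη : η * (P.L : ℝ) ^ k = 1)
    (lam : Balaban1983to89.Site P (i + k) → ℝ) (b : PBond P i) :
    (torusBlockBondsIter P i k).Qsstar (grad 1 lam) b = grad η⁻¹ (fun x => lam (blockOfIter k x)) b := by
  rw [Qsstar_grad hk, one_mul]
  congr 1
  have hη0 : η ≠ 0 := by
    rintro rfl
    simp at hη
  field_simp
  linarith [hη]

/-- kernel: the pull-back of the trivial configuration is trivial, `Q^{s*}_k1 = 1` (any value type; standing range).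
[cite: BalabanImbrieJaffe1985, (4.5.3) p.312] -/
theorem qsstarGIter_one [One G] {k : ℕ} (hk : i + k ≤ P.m + P.K) (b : PBond P i) :
    qsstarGIter k (fun _ : PBond P (i + k) => (1 : G)) b = 1 := by
  rw [qsstarGIter_eq k hk]
  split_ifs <;> rfl

/-- **`Q^{s*}_k(1^g) = 1^{g∘B^k}`** — the pull-back of a PURE GAUGE on the unit lattice is the pure gauge on the η-lattice of the
block-constant gauge function `g∘B^k` (gen 3's gauge covariance `qsstarGIter_gaugeAct` at the trivial field; any gauge group; standing range):
*"Q^{s*}_ke^{ie_k∂λ} is a gauge transformation (generated by Q′^*_kλ)"*. [cite: BalabanImbrieJaffe1988, (5.6.4) p.286] -/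
theorem qsstarGIter_gaugeAct_one [GaugeGroup G] {k : ℕ} (hk : i + k ≤ P.m + P.K) (g : GaugeTransf P (i + k) G) :
    qsstarGIter k (gaugeAct g (fun _ : PBond P (i + k) => (1 : G))) =
      gaugeAct (fun x => g (blockOfIter k x)) (fun _ : PBond P i => (1 : G)) := by
  rw [qsstarGIter_gaugeAct k hk]
  funext b
  simp only [gaugeAct, qsstarGIter_one hk]

/-- kernel: for U(1), the pure gauge `1^g` with `g = e^{−ie_kλ}` IS the field `e^{ie_k∂λ}` (`(1^g)(b) = g(b₋)g(b₊)^{−1} = e^{ie_k(λ(b₊) − λ(b₋))}`,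
`Setup`'s `gaugeAct`). [cite: BalabanImbrieJaffe1988, (5.6.4) p.286] -/
theorem gaugeAct_one_eq_phaseField {n : ℕ} (ek : ℝ) (lam : Balaban1983to89.Site P n → ℝ) :
    gaugeAct (fun x => expU1 (-(ek * lam x))) (fun _ : PBond P n => (1 : U1)) = phaseField fun c => ek * grad 1 lam c := by
  funext b
  apply BIJ88Sect3Rescaling.toC_injective_U1
  simp only [gaugeAct, mul_one, toC_mul, toC_inv', toC_expU1, toC_phaseField, grad, one_smul]
  rw [← Complex.exp_neg, ← Complex.exp_add]
  congr 1
  push_cast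
  ring

/-- **`Q^{s*}_ke^{ie_k∂λ} = e^{ie_k∂(λ∘B^k)}` read in `ℂ`, bond by bond**: the pulled-back pure gauge on the η-bond `b` is
`exp(ie_k[λ(B^kb₊) − λ(B^kb₋)])` (`1` inside k-blocks) — the phase gauge transformation of the trivial field with parameter `Q′^*_kλ = λ∘B^k`
(standing range). [cite: BalabanImbrieJaffe1988, (5.6.4) p.286] -/
theorem cfg_qsstarGIter_pureGauge {k : ℕ} (hk : i + k ≤ P.m + P.K) (ek : ℝ) (lam : Balaban1983to89.Site P (i + k) → ℝ) (b : PBond P i) :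
    cfg (qsstarGIter k (phaseField fun c => ek * grad 1 lam c)) b =
      Complex.exp (I * ((ek * (lam (blockOfIter k b.tgt) - lam (blockOfIter k b.src)) : ℝ) : ℂ)) := by
  simp only [cfg]
  by_cases hb : blockOfIter k b.tgt = blockOfIter k b.src
  · rw [qsstarGIter_of_interior hk _ hb.symm, toC_one, hb, sub_self, mul_zero]
    simp
  · rw [qsstarGIter_of_mem hk _ (mem_BsIter_of_not_interior hk hb), toC_phaseField, blockOfIter_tgt_of_not_interior hk hb]
    simp only [grad, one_smul]
    rw [mul_comm _ I]
    rfl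

/-- **… IS r18's phase gauge transformation `gaugeU` of the trivial field with parameter `−e_k(λ∘B^k)`** (`gaugeU μ u (b) = e^{iμ(b₋)}u_be^{−iμ(b₊)}`,
Sect. 3; standing range). [cite: BalabanImbrieJaffe1988, (5.6.4) p.286] -/
theorem cfg_qsstarGIter_pureGauge_eq_gaugeU {k : ℕ} (hk : i + k ≤ P.m + P.K) (ek : ℝ) (lam : Balaban1983to89.Site P (i + k) → ℝ) :
    cfg (qsstarGIter k (phaseField fun c => ek * grad 1 lam c)) =
      gaugeU (fun x => -(ek * lam (blockOfIter k x))) (fun _ : PBond P i => (1 : ℂ)) := by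
  funext b
  rw [cfg_qsstarGIter_pureGauge hk, gaugeU, mul_one, ← Complex.exp_add]
  congr 1
  push_cast
  simp only [PBond.tgt]
  ring

/-- **… IS the background gauge transformation (4.16) `u_{k,b} → u_{k,b}e^{−ie_kη(∂^ημ)(b)}` of the trivial field with `μ = −λ∘B^k`** (r18's
`bgGaugeU e_k η μ 1`, any `η ≠ 0`) — *"generated by Q′^*_kλ"* (standing range). [cite: BalabanImbrieJaffe1988, (4.16) p.276] -/
theorem cfg_qsstarGIter_pureGauge_eq_bgGaugeU {k : ℕ} (hk : i + k ≤ P.m + P.K) (ek : ℝ) {η : ℝ} (hη : η ≠ 0)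
    (lam : Balaban1983to89.Site P (i + k) → ℝ) :
    cfg (qsstarGIter k (phaseField fun c => ek * grad 1 lam c)) =
      bgGaugeU ek η (fun x => -lam (blockOfIter k x)) (fun _ : PBond P i => (1 : ℂ)) := by
  funext b
  rw [cfg_qsstarGIter_pureGauge hk, bgGaugeU, one_mul]
  congr 1
  simp only [grad, smul_eq_mul]
  have hc : η * (η⁻¹ * (-lam (blockOfIter k b.tgt) - -lam (blockOfIter k b.src))) =
      -(lam (blockOfIter k b.tgt) - lam (blockOfIter k b.src)) := by
    rw [← mul_assoc, mul_inv_cancel₀ hη, one_mul]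
    ring
  rw [mul_assoc ek η, hc]
  push_cast
  ring

/-! ## §2 (5.6.3)–(5.6.4) on the torus -/

/-- kernel: the U(1) dictionary [BalabanImbrieJaffe1985] (4.5.2) = (4.5.3) without a cut-off: `Q^{s*}_ke^{ie_kA} = exp(ie_kηQ^{s*}_kA)` read in `ℂ`
(`ηL^k = 1`; standing range). [cite: BalabanImbrieJaffe1985, (4.5.2) p.312] -/
theorem toC_qsstarGIter_phaseField {k : ℕ} (hk : i + k ≤ P.m + P.K) {ek η : ℝ} (hη : η * (P.L : ℝ) ^ k = 1) (A : PBond P (i + k) → ℝ)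
    (b : PBond P i) :
    toC (qsstarGIter k (phaseField fun c => ek * A c) b) =
      Complex.exp (I * ((ek * η * (torusBlockBondsIter P i k).Qsstar A b : ℝ) : ℂ)) := by
  have h := toC_qsstarGIter_cutoffG_phase (i := i) (k := k) hk hη Finset.univ (u' := phaseField fun c => ek * A c) (A' := A)
    (fun c _ => rfl) b
  have hcut : cutoffG (Finset.univ : Finset (PBond P (i + k))) (phaseField fun c => ek * A c) = phaseField fun c => ek * A c := by
    funext c
    exact cutoffG_of_mem _ (Finset.mem_univ c)
  rw [hcut, Finset.coe_univ, Set.indicator_univ] at h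
  exact h

/-- **(5.6.3)–(5.6.4) ON THE TORUS.**  Hypothesis `hu` (p. 286, for the unit-lattice field on the bonds `□′* = X*`): *"we can write u =
exp[ie_k(∂λ + B)]"*; `g` = `𝒟_{k,loc}∂*Q^{e*}_kf^{(k)}` (data, as in the typed (4.2)).  Then at every η-bond `b` under `□′` (`b ∈ (blockUnion k X)*`)
the background field (5.6.3) `u_k = (Q^{s*}_ku) exp[−ie_kηg]` equals `(Q^{s*}_ke^{ie_k∂λ})(b) · exp ie_kη[(Q^{s*}_kB)(b) − g(b)]` (`ηL^k = 1`;
multiplicativity of the pull-back and the U(1) dictionary; standing range). [cite: BalabanImbrieJaffe1988, (5.6.4) p.286] -/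
theorem eq564_torus {k : ℕ} (hk : i + k ≤ P.m + P.K) {ek η : ℝ} (hη : η * (P.L : ℝ) ^ k = 1) (X : Finset (Balaban1983to89.Site P (i + k)))
    {lam : Balaban1983to89.Site P (i + k) → ℝ} {B : PBond P (i + k) → ℝ} {u : GaugeField P (i + k) U1}
    (hu : ∀ c ∈ starB X, u c = expU1 (ek * (grad 1 lam c + B c))) (g : PBond P i → ℝ) {b : PBond P i}
    (hb : b ∈ starB (blockUnion k X)) :
    backgroundU ek η (cfg (qsstarGIter k u)) g b =
      cfg (qsstarGIter k (phaseField fun c => ek * grad 1 lam c)) b *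
        Complex.exp (I * ((ek * η * ((torusBlockBondsIter P i k).Qsstar B b - g b) : ℝ) : ℂ)) := by
  have hsplit : cfg (qsstarGIter k u) b = cfg (qsstarGIter k (phaseField fun c => ek * grad 1 lam c)) b *
      Complex.exp (I * ((ek * η * (torusBlockBondsIter P i k).Qsstar B b : ℝ) : ℂ)) := by
    rw [← toC_qsstarGIter_phaseField hk hη B b]
    simp only [cfg]
    by_cases hi : blockOfIter k b.tgt = blockOfIter k b.src
    · rw [qsstarGIter_of_interior hk _ hi.symm, qsstarGIter_of_interior hk _ hi.symm, qsstarGIter_of_interior hk _ hi.symm, toC_one,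
        mul_one]
    · have hmem := mem_BsIter_of_not_interior hk hi
      have hc : (⟨blockOfIter k b.src, b.dir⟩ : PBond P (i + k)) ∈ starB X :=
        mem_liftBonds.1 ((liftBonds_starB_iff hk X hi).2 hb)
      rw [qsstarGIter_of_mem hk _ hmem, qsstarGIter_of_mem hk _ hmem, qsstarGIter_of_mem hk _ hmem, hu _ hc, toC_expU1,
        toC_phaseField, toC_phaseField, ← Complex.exp_add]
      congr 1
      push_cast
      ring
  simp only [backgroundU]
  rw [hsplit, mul_assoc, ← Complex.exp_add]
  congr 2
  push_cast
  ring

/-- **(5.6.4), the display**: under the hypotheses of `eq564_torus` and the displayed consequence `hT` of *"We have used the fact that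
𝒟_{k,loc} has range (1/2L)r(e_{k−1})"* together with *"f^{(k)} = ∂B in the cube"* — on the bond considered `g(b) = (T∂B)(b)`, `T` =
`𝒟_{k,loc}∂*Q^{e*}_k` (data), `∂` = the unit-lattice curl — **`u_k(b) = (Q^{s*}_ke^{ie_k∂λ})(b) · exp ie_kη[((Q^{s*}_k − T∂)B)(b)]`**
(standing range). [cite: BalabanImbrieJaffe1988, (5.6.4) p.286] -/
theorem eq564 {k : ℕ} (hk : i + k ≤ P.m + P.K) {ek η : ℝ} (hη : η * (P.L : ℝ) ^ k = 1) (X : Finset (Balaban1983to89.Site P (i + k)))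
    {lam : Balaban1983to89.Site P (i + k) → ℝ} {B : PBond P (i + k) → ℝ} {u : GaugeField P (i + k) U1}
    (hu : ∀ c ∈ starB X, u c = expU1 (ek * (grad 1 lam c + B c))) (g : PBond P i → ℝ)
    (T : (Balaban1983to89.Plaq P (i + k) → ℝ) → (PBond P i → ℝ)) {b : PBond P i} (hb : b ∈ starB (blockUnion k X))
    (hT : g b = T (curl 1 B) b) :
    backgroundU ek η (cfg (qsstarGIter k u)) g b =
      cfg (qsstarGIter k (phaseField fun c => ek * grad 1 lam c)) b *
        Complex.exp (I * ((ek * η * ((torusBlockBondsIter P i k).Qsstar B - T (curl 1 B)) b : ℝ) : ℂ)) := by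
  rw [eq564_torus hk hη X hu g hb, Pi.sub_apply, hT]

/-- kernel: the plaquette variable depends only on the four bonds of the plaquette — two fields agreeing there have the same `u(∂p)`.
[cite: BalabanImbrieJaffe1988, (3.5) p.266] -/
theorem plaqHol_eq_of_bonds {n : ℕ} {u v : GaugeField P n U1} {p : Balaban1983to89.Plaq P n}
    (h1 : u ⟨p.src, p.μ⟩ = v ⟨p.src, p.μ⟩) (h2 : u ⟨p.src.shift p.μ, p.ν⟩ = v ⟨p.src.shift p.μ, p.ν⟩)
    (h3 : u ⟨p.src.shift p.ν, p.μ⟩ = v ⟨p.src.shift p.ν, p.μ⟩) (h4 : u ⟨p.src, p.ν⟩ = v ⟨p.src, p.ν⟩) :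
    plaqHol u p = plaqHol v p := by
  simp only [GaugeField.plaqHol, h1, h2, h3, h4]

/-- **"We have f^{(k)} = ∂B in the cube"**: if `u = e^{ie_k(∂λ + B)}` on the four bonds of the plaquette `p` and `|e_k(∂B)(p)| < π` (the principal
branch of `(ie_k)^{−1}log`), then `f^{(k)}(p) = (ie_k)^{−1} log u(p) = (∂B)(p)` — the pure gauge drops out (`curl_grad`), `e_k ≠ 0`.
[cite: BalabanImbrieJaffe1988, (5.6.4) p.286] -/
theorem fieldStrength_eq_curl {n : ℕ} {ek : ℝ} (hek : ek ≠ 0) {lam : Balaban1983to89.Site P n → ℝ} {B : PBond P n → ℝ}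
    {u : GaugeField P n U1} {p : Balaban1983to89.Plaq P n}
    (h1 : u ⟨p.src, p.μ⟩ = expU1 (ek * (grad 1 lam ⟨p.src, p.μ⟩ + B ⟨p.src, p.μ⟩)))
    (h2 : u ⟨p.src.shift p.μ, p.ν⟩ = expU1 (ek * (grad 1 lam ⟨p.src.shift p.μ, p.ν⟩ + B ⟨p.src.shift p.μ, p.ν⟩)))
    (h3 : u ⟨p.src.shift p.ν, p.μ⟩ = expU1 (ek * (grad 1 lam ⟨p.src.shift p.ν, p.μ⟩ + B ⟨p.src.shift p.ν, p.μ⟩)))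
    (h4 : u ⟨p.src, p.ν⟩ = expU1 (ek * (grad 1 lam ⟨p.src, p.ν⟩ + B ⟨p.src, p.ν⟩)))
    (hsmall : |ek * curl 1 B p| < π) :
    fieldStrength ek (toC (plaqHol u p)) = ((curl 1 B p : ℝ) : ℂ) := by
  have hp : plaqHol u p = plaqHol (phaseField fun c => ek * (fun c => grad 1 lam c + B c) c) p :=
    plaqHol_eq_of_bonds h1 h2 h3 h4
  have hcurl : curl 1 (fun c => grad 1 lam c + B c) p = curl 1 B p := by
    rw [curl_add, curl_grad, zero_add]
  rw [hp, BIJ88Eq532Torus.toC_plaqHol_phaseField, hcurl, fieldStrength_exp_of_small hek hsmall]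

/-- … and for a plaquette of `□′** = X**` when `u = e^{ie_k(∂λ + B)}` on `□′* = X*`. [cite: BalabanImbrieJaffe1988, (5.6.4) p.286] -/
theorem fieldStrength_eq_curl_of_mem_starP {n : ℕ} {ek : ℝ} (hek : ek ≠ 0) (X : Finset (Balaban1983to89.Site P n))
    {lam : Balaban1983to89.Site P n → ℝ} {B : PBond P n → ℝ} {u : GaugeField P n U1}
    (hu : ∀ c ∈ starB X, u c = expU1 (ek * (grad 1 lam c + B c))) {p : Balaban1983to89.Plaq P n} (hp : p ∈ starP X)
    (hsmall : |ek * curl 1 B p| < π) :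
    fieldStrength ek (toC (plaqHol u p)) = ((curl 1 B p : ℝ) : ℂ) := by
  simp only [starP, Finset.mem_filter, Finset.mem_univ, true_and] at hp
  obtain ⟨hx, hxμ, hxν, hxμν⟩ := hp
  refine fieldStrength_eq_curl hek (hu _ ?_) (hu _ ?_) (hu _ ?_) (hu _ ?_) hsmall
  · exact (mem_starB X _).2 ⟨hx, hxμ⟩
  · exact (mem_starB X _).2 ⟨hxμ, hxμν⟩
  · refine (mem_starB X _).2 ⟨hxν, ?_⟩
    show (p.src.shift p.ν).shift p.μ ∈ X
    rw [← shift_comm]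
    exact hxμν
  · exact (mem_starB X _).2 ⟨hx, hxν⟩

/-! ## §3 *"so we can delete it from u_k"* -/

/-- **`u_k = gaugeU(−e_kλ∘B^k)(exp ie_kη[Q^{s*}_kB − g])` on the bonds under `□′`**: the background field (5.6.3) IS a phase gauge transform
(r18's `gaugeU`) of the gauge-deleted field `exp ie_kη[(Q^{s*}_kB)(b) − g(b)]` (standing range). [cite: BalabanImbrieJaffe1988, (5.6.4) p.286] -/
theorem eq564_gaugeU {k : ℕ} (hk : i + k ≤ P.m + P.K) {ek η : ℝ} (hη : η * (P.L : ℝ) ^ k = 1) (X : Finset (Balaban1983to89.Site P (i + k)))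
    {lam : Balaban1983to89.Site P (i + k) → ℝ} {B : PBond P (i + k) → ℝ} {u : GaugeField P (i + k) U1}
    (hu : ∀ c ∈ starB X, u c = expU1 (ek * (grad 1 lam c + B c))) (g : PBond P i → ℝ) {b : PBond P i}
    (hb : b ∈ starB (blockUnion k X)) :
    backgroundU ek η (cfg (qsstarGIter k u)) g b =
      gaugeU (fun x => -(ek * lam (blockOfIter k x)))
        (bgExp ek η (fun _ => (1 : ℂ)) fun b => (torusBlockBondsIter P i k).Qsstar B b - g b) b := by
  rw [eq564_torus hk hη X hu g hb, cfg_qsstarGIter_pureGauge_eq_gaugeU hk, gaugeU, gaugeU, bgExp, mul_one, one_mul]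
  ring

/-- kernel: `X ⊆ Y ⟹ X* ⊆ Y*`. [cite: BalabanImbrieJaffe1988, (3.5) p.266] -/
theorem starB_mono {n : ℕ} {X Y : Finset (Balaban1983to89.Site P n)} (h : X ⊆ Y) : starB X ⊆ starB Y := by
  intro b hb
  rw [mem_starB] at hb ⊢
  exact ⟨h hb.1, h hb.2⟩

/-- **"Note that Q^{s*}_ke^{ie_k∂λ} is a gauge transformation …, so we can delete it from u_k"**: for every family of cubes (r16's labelling
`cube`, labels `G`) lying inside `□̄′ = blockUnion k X` (the η-blocks under `□′`), r16's regularity predicate `Regular286` ((4.3) on each cube)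
for the background field `u_k` of (5.6.3) FOLLOWS from the same predicate for the gauge-deleted field `exp ie_kη[Q^{s*}_kB − g]` — r16's
`regular286_of_eqOn_gaugeU` ((4.3) is gauge invariant) applied to `eq564_gaugeU` (standing range).  The bound for the deleted field is the
business of (5.6.5) and the kernel estimates of Sect. 2 (not asserted here). [cite: BalabanImbrieJaffe1988, (4.3) p.286] -/
theorem regular286_of_deleted {k : ℕ} (hk : i + k ≤ P.m + P.K) {ek η : ℝ} (hη : η * (P.L : ℝ) ^ k = 1)
    (X : Finset (Balaban1983to89.Site P (i + k))) {lam : Balaban1983to89.Site P (i + k) → ℝ} {B : PBond P (i + k) → ℝ}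
    {u : GaugeField P (i + k) U1} (hu : ∀ c ∈ starB X, u c = expU1 (ek * (grad 1 lam c + B c))) (g : PBond P i → ℝ)
    {γ : Type*} (cube : Balaban1983to89.Site P i → γ) {Gs : Set γ} (hG : ∀ l ∈ Gs, cubeSites cube l ⊆ blockUnion k X)
    {c pek rek : ℝ}
    (h43 : Regular286 cube Gs ek η c pek rek (bgExp ek η (fun _ => (1 : ℂ)) fun b => (torusBlockBondsIter P i k).Qsstar B b - g b)) :
    Regular286 cube Gs ek η c pek rek (backgroundU ek η (cfg (qsstarGIter k u)) g) :=
  regular286_of_eqOn_gaugeU (fun x => -(ek * lam (blockOfIter k x)))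
    (fun l hl _ hb => eq564_gaugeU hk hη X hu g (starB_mono (hG l hl) hb)) h43

/-! ## §4 The paragraph assembled: *"Our desired bound now follows because by (5.4.4), (5.6.5) … so A^λ, ∂A^λ, ∂*A^λ are finally all
bounded by cp(e_k)r(e_k)"* (v1.1) -/

/-- **The (4.3) representation read back as `hu`** (*"we can write u = exp[ie_k(∂λ + B)]"*): at a bond where the gauge transform `u^λ`
(r18's `gaugeU λ`) of the U(1) field `u` is the pure phase `e^{ie_k·1·A(b)}` — the first clause of r18's `Smooth43` at `ζ = 1`; for the
corner-rooted axial gauge of a box this is p36's `BIJ88Smooth43Axial.gaugeU_axial_eq_exp` with `A = axialB`, `λ = lamOf h` — one has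
`u(b) = exp[ie_k((∂(λ/e_k))(b) + A(b))]`, the hypothesis `hu` of `eq564` (`lam := λ/e_k`, `B := A`). [cite: BalabanImbrieJaffe1988, (4.3) p.286] -/
theorem expU1_of_gaugeU_eq_exp {n : ℕ} {u : GaugeField P n U1} {lam : Balaban1983to89.Site P n → ℝ} {A : PBond P n → ℝ} {ek : ℝ}
    (hek : ek ≠ 0) {b : PBond P n} (h : gaugeU lam (cfg u) b = exp (I * ((ek * 1 * A b : ℝ) : ℂ))) :
    u b = expU1 (ek * (grad 1 (fun x => lam x / ek) b + A b)) := by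
  apply toC_injective_U1
  simp only [gaugeU, cfg] at h
  have e1 : exp (-((lam b.src : ℂ) * I)) * exp ((lam b.src : ℂ) * I) = 1 := by
    rw [← Complex.exp_add, neg_add_cancel, Complex.exp_zero]
  have e2 : exp (-((lam b.tgt : ℂ) * I)) * exp ((lam b.tgt : ℂ) * I) = 1 := by
    rw [← Complex.exp_add, neg_add_cancel, Complex.exp_zero]
  have key : toC (u b) =
      exp (-((lam b.src : ℂ) * I)) * (exp ((lam b.src : ℂ) * I) * toC (u b) * exp (-((lam b.tgt : ℂ) * I))) *
        exp ((lam b.tgt : ℂ) * I) := by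
    calc toC (u b) = (exp (-((lam b.src : ℂ) * I)) * exp ((lam b.src : ℂ) * I)) * toC (u b) *
          (exp (-((lam b.tgt : ℂ) * I)) * exp ((lam b.tgt : ℂ) * I)) := by rw [e1, e2, one_mul, mul_one]
      _ = _ := by ring
  rw [key, h, toC_expU1, ← Complex.exp_add, ← Complex.exp_add]
  congr 1
  simp only [grad, smul_eq_mul, one_mul]
  have hekC : (ek : ℂ) ≠ 0 := by exact_mod_cast hek
  push_cast
  field_simp
  ring

/-- **`Regular286` of `u_k` from the three bounds on the gauge-deleted exponent.**  If on every cube of the family (inside `□̄′ = blockUnion k X`)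
the real η-bond function `G = Q^{s*}_kB − g` (in print `(Q^{s*}_k − 𝒟_{k,loc}∂*Q^{e*}_k∂)□′B = (H_{k,loc} + ∂C_k + w₁)□′B`, (5.6.5)) satisfies
`|G| ≦ cpr` on the cube's bonds, `|∂^ηG| ≦ cpr` on its plaquettes and `|∂^{η*}G| ≦ cpr` on its sites, then the background field `u_k` of (5.6.3)
satisfies r16's `Regular286` there with the same constant: gauge deletion (`regular286_of_deleted`) + p36's `regular286_exp` (a pure phase with
the three bounds is (4.3)-smooth, `λ = 0`). [cite: BalabanImbrieJaffe1988, (4.3) p.286] -/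
theorem regular286_backgroundU_of_bounds {k : ℕ} (hk : i + k ≤ P.m + P.K) {ek η : ℝ} (hη : η * (P.L : ℝ) ^ k = 1)
    (X : Finset (Balaban1983to89.Site P (i + k))) {lam : Balaban1983to89.Site P (i + k) → ℝ} {B : PBond P (i + k) → ℝ}
    {u : GaugeField P (i + k) U1} (hu : ∀ c ∈ starB X, u c = expU1 (ek * (grad 1 lam c + B c))) (g : PBond P i → ℝ)
    {γ : Type*} (cube : Balaban1983to89.Site P i → γ) {Gs : Set γ} (hG : ∀ l ∈ Gs, cubeSites cube l ⊆ blockUnion k X)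
    {c pek rek : ℝ}
    (h₁ : ∀ l ∈ Gs, ∀ b ∈ starB (cubeSites cube l), |(torusBlockBondsIter P i k).Qsstar B b - g b| ≤ c * pek * rek)
    (h₂ : ∀ l ∈ Gs, ∀ p ∈ starP (cubeSites cube l),
      |curl η⁻¹ (fun b => (torusBlockBondsIter P i k).Qsstar B b - g b) p| ≤ c * pek * rek)
    (h₃ : ∀ l ∈ Gs, ∀ x ∈ cubeSites cube l,
      |diverg η⁻¹ (fun b => (torusBlockBondsIter P i k).Qsstar B b - g b) x| ≤ c * pek * rek) :
    Regular286 cube Gs ek η c pek rek (backgroundU ek η (cfg (qsstarGIter k u)) g) := by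
  refine regular286_of_deleted hk hη X hu g cube hG ?_
  have hfun : (bgExp ek η (fun _ => (1 : ℂ)) fun b => (torusBlockBondsIter P i k).Qsstar B b - g b) =
      fun b => exp (I * ((ek * η * ((torusBlockBondsIter P i k).Qsstar B b - g b) : ℝ) : ℂ)) := by
    funext b
    simp only [bgExp, one_mul]
  rw [hfun]
  exact regular286_exp h₁ h₂ h₃

/-- **The printed hence-chain, (5.6.5) + "the kernels … and their derivatives are bounded" ⟹ the regularity of `u_k`.**  Data, as printed:
on the bonds of each cube of the family the gauge-deleted exponent is a kernel field, `(Q^{s*}_kB − g)(b) = Σ_{b′} K(b,b′)B′(b′)` (`h565`: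
(5.6.5) with `K` = `H_{k,loc} + ∂C_k + w₁` by (5.4.4) — r16's `BIJ88Sect5StatementsPart3.eq565` at the operator level — and `B′` = `□′B`);
`|B′| ≦ M` (in print `M = cp(e_k)r(e_k)`); the row sums of `K`, `∂^ηK(·,b′)`, `∂^{η*}K(·,b′)` on the cube's bonds / plaquettes / sites are
`≦ K₀, K₁, K₂` with `K_iM ≦ c·p(e_k)·r(e_k)`.  Conclusion: r16's `Regular286` for `u_k = backgroundU` on the family — p36's `smooth43_exp_kernel`
cube by cube, r16's `regular286_of_eqOn`, and gauge deletion `regular286_of_deleted`. [cite: BalabanImbrieJaffe1988, (4.3) p.286] -/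
theorem regular286_backgroundU_of_kernel {k : ℕ} (hk : i + k ≤ P.m + P.K) {ek η : ℝ} (hη : η * (P.L : ℝ) ^ k = 1)
    (X : Finset (Balaban1983to89.Site P (i + k))) {lam : Balaban1983to89.Site P (i + k) → ℝ} {B : PBond P (i + k) → ℝ}
    {u : GaugeField P (i + k) U1} (hu : ∀ c ∈ starB X, u c = expU1 (ek * (grad 1 lam c + B c))) (g : PBond P i → ℝ)
    {γ : Type*} (cube : Balaban1983to89.Site P i → γ) {Gs : Set γ} (hG : ∀ l ∈ Gs, cubeSites cube l ⊆ blockUnion k X)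
    {c pek rek M K₀ K₁ K₂ : ℝ} {K : PBond P i → PBond P i → ℝ} {B' : PBond P i → ℝ}
    (h565 : ∀ l ∈ Gs, ∀ b ∈ starB (cubeSites cube l),
      (torusBlockBondsIter P i k).Qsstar B b - g b = ∑ b', K b b' * B' b')
    (hM : 0 ≤ M) (hB' : ∀ b', |B' b'| ≤ M) (hK₀ : ∀ l ∈ Gs, ∀ b ∈ starB (cubeSites cube l), ∑ b', |K b b'| ≤ K₀)
    (hK₁ : ∀ l ∈ Gs, ∀ p ∈ starP (cubeSites cube l), ∑ b', |curl η⁻¹ (fun b => K b b') p| ≤ K₁)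
    (hK₂ : ∀ l ∈ Gs, ∀ x ∈ cubeSites cube l, ∑ b', |diverg η⁻¹ (fun b => K b b') x| ≤ K₂)
    (h₀ : K₀ * M ≤ c * pek * rek) (h₁ : K₁ * M ≤ c * pek * rek) (h₂ : K₂ * M ≤ c * pek * rek) :
    Regular286 cube Gs ek η c pek rek (backgroundU ek η (cfg (qsstarGIter k u)) g) := by
  refine regular286_of_deleted hk hη X hu g cube hG ?_
  refine regular286_of_eqOn (uk := fun b => exp (I * ((ek * η * ∑ b', K b b' * B' b' : ℝ) : ℂ)))
    (fun l hl b hb => ?_) fun l hl => ?_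
  · simp only [bgExp, one_mul, h565 l hl b hb]
  · exact smooth43_exp_kernel hM hB' (hK₀ l hl) (hK₁ l hl) (hK₂ l hl) h₀ h₁ h₂

end

end Literature.MathematicalPhysics.QuantumFieldTheory.BalabanImbrieJaffe1984to88.BIJ88Eq564Torus
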